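import Mathlib
import Summits.ResolutionOfSingularities.ResolutionOfSingularities.Theorems.IndSmoothSmoothToUniformizingDrMvPolynomialMaximal
import HarnessLib

/-!
# One blow-up along a discrete valuation: the `t`-chart
# (stmt-ResolutionOfSingularities-16088, line `birth`, branch DiscreteRange,
# S3b `stub_dr_blowupStep`)

Let `O ⊆ K` be a valuation ring, `t ∈ O` an element with `v(t) < 1` such that every non-zero
value is an integral power of `v(t)` (a uniformizer of a discrete rank-one valuation), and assume
every residue of `O` is algebraic over the ground field `k` (`hres`). Let `C ⊆ O` be a finitely
generated `k`-subalgebra containing `t` whose centre `𝔠 = 𝔪_O ∩ C` is generated by `t` and `n`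
further elements `g₁, …, gₙ`. The blow-up of `C` at `𝔠` in the `t`-chart is
`C' := C[g₁/t, …, gₙ/t] ⊆ O` (`gᵢ/t ∈ O` because `v(gᵢ) < 1` forces `v(gᵢ) ≤ v(t)` by
discreteness). We prove: `C'` is finitely generated, `C ≤ C' ⊆ C[1/t]`, every element of the old
centre becomes divisible by `t` in `C'`, and — the heart — the new centre `𝔠' = 𝔪_O ∩ C'` is again
generated by `t` and `n` elements.

Proof of the heart. Centres are MAXIMAL ideals: `D/(𝔪_O ∩ D)` embeds in the residue field of `O`,
which is algebraic over `k`, so it is a domain integral over a field, hence a field. Put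
`κ := C/𝔠`. The `C`-algebra presentation `Φ : C[X₁,…,Xₙ] → C'`, `Xᵢ ↦ gᵢ/t`, is surjective, so
`N := Φ⁻¹(𝔠')` is maximal; the coefficient reduction `ρ : C[X] → κ[X]` is surjective with kernel
`𝔠·C[X] ⊆ N` (constants of `𝔠` have value `< 1`), so `M := ρ(N)` is a maximal ideal of
`κ[X₁,…,Xₙ]`, generated by `n` elements `h₁,…,hₙ` (input `stub_dr_mvPolynomial_maximal_span`:
maximal ideals of polynomial rings in `n` variables over a field need `n` generators). Lift
`hᵢ = ρ(Hᵢ)` with `Hᵢ ∈ N` and put `g'ᵢ := Φ(Hᵢ) ∈ 𝔠'`. For `x = Φ(P) ∈ 𝔠'`: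
`ρ(P) = Σ qᵢ hᵢ`, so `P - Σ Qᵢ Hᵢ ∈ ker ρ = 𝔠·C[X]` and
`x - Σ Φ(Qᵢ) g'ᵢ ∈ Φ(𝔠·C[X]) = 𝔠·C' = (t, g₁, …, gₙ)C' = t·C'` (as `gᵢ = t · (gᵢ/t)`). Hence
`𝔠' = (t, g'₁, …, g'ₙ)`.

References: standard (the discrete rank-one zero-dimensional case of local uniformization by
blowing up the centre); O. Zariski, *Local uniformization on algebraic varieties*, Ann. of Math.
41 (1940) 852–896. Folklore.
-/

noncomputable section

-- single-problem summit: the doubled namespace component `ResolutionOfSingularities` is forced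
set_option linter.dupNamespace false

open IsLocalRing

namespace Summit.ResolutionOfSingularities.ResolutionOfSingularities.Theorems.IndSmoothBirth

/-! ## Centres of a valuation ring on subalgebras -/

/-- Membership in the centre `𝔪_O ∩ D` of a valuation ring `O` on a subalgebra `D ⊆ O` is the
condition `v < 1`. [folklore] -/
theorem mem_comap_inclusion_maximalIdeal_iff {k K : Type} [Field k] [Field K] [Algebra k K]
    (O : ValuationSubring K) {D : Subalgebra k K} (hD : D.toSubring ≤ O.toSubring) (x : D) :
    x ∈ Ideal.comap (Subring.inclusion hD) (maximalIdeal O) ↔ O.valuation (x : K) < 1 := by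
  rw [Ideal.mem_comap, ValuationSubring.valuation_lt_one_iff]
  rfl

/-- If every residue of the valuation ring `O` is algebraic over `k` (every `x ∈ O` satisfies a
monic polynomial over `k` up to an element of `𝔪_O`), then the centre `𝔪_O ∩ D` of `O` on any
`k`-subalgebra `D ⊆ O` is a MAXIMAL ideal: `D/(𝔪_O ∩ D)` is a domain, integral over the field `k`,
hence a field. [folklore] -/
theorem isMaximal_comap_inclusion_maximalIdeal {k K : Type} [Field k] [Field K] [Algebra k K]
    (O : ValuationSubring K)
    (hres : ∀ x : K, x ∈ O → ∃ g : Polynomial k, g.Monic ∧ O.valuation (Polynomial.aeval x g) < 1)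
    {D : Subalgebra k K} (hD : D.toSubring ≤ O.toSubring) :
    (Ideal.comap (Subring.inclusion hD) (maximalIdeal O)).IsMaximal := by
  set 𝔪 : Ideal D := Ideal.comap (Subring.inclusion hD) (maximalIdeal O) with h𝔪
  haveI : 𝔪.IsPrime := Ideal.comap_isPrime _ _
  haveI : Algebra.IsIntegral k (D ⧸ 𝔪) := ⟨fun y => by
    obtain ⟨x, rfl⟩ := Ideal.Quotient.mk_surjective y
    obtain ⟨p, hp, hv⟩ := hres x (hD x.2)
    refine ⟨p, hp, ?_⟩
    have h1 : Polynomial.aeval (Ideal.Quotient.mk 𝔪 x) p =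
        Ideal.Quotient.mk 𝔪 (Polynomial.aeval x p) :=
      Polynomial.aeval_algHom_apply (Ideal.Quotient.mkₐ k 𝔪) x p
    rw [← Polynomial.aeval_def, h1, Ideal.Quotient.eq_zero_iff_mem,
      mem_comap_inclusion_maximalIdeal_iff, Polynomial.aeval_subalgebra_coe]
    exact hv⟩
  exact Ideal.Quotient.maximal_of_isField _
    (isField_of_isIntegral_of_isField' (R := k) (S := D ⧸ 𝔪) (Field.toIsField k))

/-- Along a discrete valuation with uniformizer `t` (`v(t) < 1`, every non-zero value an integral
power of `v(t)`), an element of value `< 1` has value `≤ v(t)`, i.e. is divisible by `t` in `O`.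
[folklore] -/
theorem div_mem_of_valuation_lt_one {K : Type} [Field K] (O : ValuationSubring K) {t : K}
    (ht0 : t ≠ 0) (ht1 : O.valuation t ≤ 1)
    (hunif : ∀ x : K, x ≠ 0 → ∃ n : ℤ, O.valuation x = O.valuation t ^ n)
    (hlt : O.valuation t < 1) {x : K} (hx : O.valuation x < 1) : x / t ∈ O := by
  rcases eq_or_ne x 0 with rfl | hx0
  · rw [zero_div]; exact O.zero_mem
  obtain ⟨m, hm⟩ := hunif x hx0
  have hvt0 : O.valuation t ≠ 0 := (Valuation.ne_zero_iff _).mpr ht0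
  have hvt : 0 < O.valuation t := zero_lt_iff.mpr hvt0
  have hm1 : 1 ≤ m := by
    by_contra h
    have h1 : 1 ≤ O.valuation t ^ m := one_le_zpow_of_nonpos₀ hvt ht1 (by omega)
    rw [← hm] at h1
    exact absurd hx (not_lt.mpr h1)
  rw [← O.valuation_le_one_iff, map_div₀, hm, div_eq_mul_inv, ← zpow_sub_one₀ hvt0]
  exact zpow_le_one₀ hvt hlt.le (by omega)

/-! ## The blow-up step -/

/-- **One blow-up of a finitely generated `C ⊆ O` at its centre along a discrete valuation (the
`t`-chart).** With `t` a uniformizer of the discrete valuation ring `O` (`hunif`, `hlt`), residues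
algebraic over `k` (`hres`), and the centre of `O` on `C` generated by `t, g₁, …, gₙ` (`hspan`):
the `k`-subalgebra `C' := C[g₁/t, …, gₙ/t]` lies in `O`, is finitely generated, contains `C`, is
contained in `C[1/t]`, its centre is again generated by `t` and `n` elements, and every element of
the old centre is divisible by `t` in `C'`. [folklore] -/
theorem stub_dr_blowupStep (k K : Type) [Field k] [Field K] [Algebra k K]
    (O : ValuationSubring K) (t : K) (htO : t ∈ O)
    (hunif : ∀ x : K, x ≠ 0 → ∃ n : ℤ, O.valuation x = O.valuation t ^ n)
    (hlt : O.valuation t < 1)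
    (hres : ∀ x : K, x ∈ O → ∃ g : Polynomial k, g.Monic ∧ O.valuation (Polynomial.aeval x g) < 1)
    (C : Subalgebra k K) (hC : C.toSubring ≤ O.toSubring) (hCfg : C.FG) (htC : t ∈ C)
    (n : ℕ) (g : Fin n → K) (hg : ∀ i, g i ∈ C)
    (hspan : Ideal.span (insert (⟨t, htC⟩ : C) (Set.range fun i => (⟨g i, hg i⟩ : C))) =
      Ideal.comap (Subring.inclusion hC) (IsLocalRing.maximalIdeal O)) :
    ∃ (C' : Subalgebra k K) (hC' : C'.toSubring ≤ O.toSubring), C'.FG ∧ C ≤ C' ∧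
      (∀ x ∈ C', ∃ a ∈ C, ∃ m : ℕ, x * t ^ m = a) ∧
      ∃ (htC' : t ∈ C') (g' : Fin n → K) (hg' : ∀ i, g' i ∈ C'),
        Ideal.span (insert (⟨t, htC'⟩ : C') (Set.range fun i => (⟨g' i, hg' i⟩ : C'))) =
          Ideal.comap (Subring.inclusion hC') (IsLocalRing.maximalIdeal O) ∧
        ∀ x : K, x ∈ C → O.valuation x < 1 → x / t ∈ C' := by
  classical
  -- degenerate case `t = 0` (then `O = K` and the centre is `0`): nothing to blow up
  rcases eq_or_ne t 0 with rfl | ht0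
  · exact ⟨C, hC, hCfg, le_rfl, fun x hx => ⟨x, hx, 0, by rw [pow_zero, mul_one]⟩, htC, g, hg,
      hspan, fun x _ _ => by rw [div_zero]; exact C.zero_mem⟩
  have ht1 : O.valuation t ≤ 1 := (O.valuation_le_one_iff t).mpr htO
  -- the old centre
  set 𝔠 : Ideal C := Ideal.comap (Subring.inclusion hC) (maximalIdeal O) with h𝔠def
  have hmemC : ∀ x : C, x ∈ 𝔠 ↔ O.valuation (x : K) < 1 :=
    mem_comap_inclusion_maximalIdeal_iff O hC
  have hvg : ∀ i, O.valuation (g i) < 1 := fun i =>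
    (hmemC ⟨g i, hg i⟩).mp (hspan ▸ Ideal.subset_span (Set.mem_insert_of_mem _ ⟨i, rfl⟩))
  have hgtO : ∀ i, g i / t ∈ O := fun i =>
    div_mem_of_valuation_lt_one O ht0 ht1 hunif hlt (hvg i)
  -- the blown-up algebra (`t`-chart)
  set C' : Subalgebra k K := Algebra.adjoin k ((C : Set K) ∪ Set.range fun i => g i / t)
    with hC'def
  have hCC' : C ≤ C' := fun x hx => Algebra.subset_adjoin (Or.inl hx)
  have hgt : ∀ i, g i / t ∈ C' := fun i => Algebra.subset_adjoin (Or.inr ⟨i, rfl⟩)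
  have htC' : t ∈ C' := hCC' htC
  have hC' : C'.toSubring ≤ O.toSubring := by
    intro x hx
    have hx' : x ∈ C' := hx
    refine Algebra.adjoin_induction (p := fun x _ => x ∈ O.toSubring) ?_ ?_ ?_ ?_ hx'
    · rintro x (hx | ⟨i, rfl⟩)
      · exact hC hx
      · exact hgtO i
    · exact fun r => hC (C.algebraMap_mem r)
    · exact fun x y _ _ hx hy => add_mem hx hy
    · exact fun x y _ _ hx hy => mul_mem hx hy
  have hfg : C'.FG := by
    rw [hC'def, Algebra.adjoin_union, Algebra.adjoin_eq C]
    exact hCfg.sup (Subalgebra.fg_def.mpr ⟨_, Set.finite_range _, rfl⟩)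
  -- `C' ⊆ C[1/t]`
  have hbir : ∀ x ∈ C', ∃ a ∈ C, ∃ m : ℕ, x * t ^ m = a := by
    intro x hx
    refine Algebra.adjoin_induction (p := fun x _ => ∃ a ∈ C, ∃ m : ℕ, x * t ^ m = a)
      ?_ ?_ ?_ ?_ hx
    · rintro x (hx | ⟨i, rfl⟩)
      · exact ⟨x, hx, 0, by rw [pow_zero, mul_one]⟩
      · exact ⟨g i, hg i, 1, by rw [pow_one, div_mul_cancel₀ _ ht0]⟩
    · exact fun r => ⟨_, C.algebraMap_mem r, 0, by rw [pow_zero, mul_one]⟩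
    · rintro x y - - ⟨a, ha, m, rfl⟩ ⟨b, hb, m', rfl⟩
      exact ⟨x * t ^ m * t ^ m' + y * t ^ m' * t ^ m,
        C.add_mem (C.mul_mem ha (C.pow_mem htC _)) (C.mul_mem hb (C.pow_mem htC _)),
        m + m', by ring⟩
    · rintro x y - - ⟨a, ha, m, rfl⟩ ⟨b, hb, m', rfl⟩
      exact ⟨x * t ^ m * (y * t ^ m'), C.mul_mem ha hb, m + m', by ring⟩
  -- every element of the old centre becomes divisible by `t`
  have hdiv : ∀ x : K, x ∈ C → O.valuation x < 1 → x / t ∈ C' := by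
    intro x hxC hvx
    have hx𝔠 : (⟨x, hxC⟩ : C) ∈
        Ideal.span (insert (⟨t, htC⟩ : C) (Set.range fun i => (⟨g i, hg i⟩ : C))) := by
      rw [hspan]; exact (hmemC _).mpr hvx
    suffices h : ∀ y : C,
        y ∈ Ideal.span (insert (⟨t, htC⟩ : C) (Set.range fun i => (⟨g i, hg i⟩ : C))) →
          (y : K) / t ∈ C' from h _ hx𝔠
    intro y hy
    refine Submodule.span_induction (p := fun (y : ↥C) _ => (y : K) / t ∈ C') ?_ ?_ ?_ ?_ hy
    · rintro _ (rfl | ⟨i, rfl⟩)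
      · change t / t ∈ C'
        rw [div_self ht0]; exact C'.one_mem
      · exact hgt i
    · change (0 : K) / t ∈ C'
      rw [zero_div]; exact C'.zero_mem
    · intro a b _ _ ha hb
      change ((a : K) + b) / t ∈ C'
      rw [add_div]; exact C'.add_mem ha hb
    · intro c a _ ha
      change ((c : K) * a) / t ∈ C'
      rw [mul_div_assoc]; exact C'.mul_mem (hCC' c.2) ha
  -- THE HEART: the new centre is generated by `t` and `n` further elements
  obtain ⟨g', hg', hspan'⟩ : ∃ (g' : Fin n → K) (hg' : ∀ i, g' i ∈ C'),
      Ideal.span (insert (⟨t, htC'⟩ : C') (Set.range fun i => (⟨g' i, hg' i⟩ : C'))) =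
        Ideal.comap (Subring.inclusion hC') (maximalIdeal O) := by
    set 𝔠' : Ideal C' := Ideal.comap (Subring.inclusion hC') (maximalIdeal O) with h𝔠'def
    have hmemC' : ∀ x : C', x ∈ 𝔠' ↔ O.valuation (x : K) < 1 :=
      mem_comap_inclusion_maximalIdeal_iff O hC'
    haveI h𝔠max : 𝔠.IsMaximal := isMaximal_comap_inclusion_maximalIdeal O hres hC
    haveI h𝔠'max : 𝔠'.IsMaximal := isMaximal_comap_inclusion_maximalIdeal O hres hC'
    letI : Field (C ⧸ 𝔠) := Ideal.Quotient.field 𝔠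
    -- the presentation `Φ : C[X₁, …, Xₙ] → C'`, `Xᵢ ↦ gᵢ / t`
    set ι : C →+* C' := (Subalgebra.inclusion hCC').toRingHom with hιdef
    set γ : Fin n → C' := fun i => ⟨g i / t, hgt i⟩ with hγdef
    set Φ : MvPolynomial (Fin n) C →+* C' := MvPolynomial.eval₂Hom ι γ with hΦdef
    have hΦC : ∀ c : C, Φ (MvPolynomial.C c) = ι c := fun c => MvPolynomial.eval₂Hom_C _ _ c
    have hΦX : ∀ i, Φ (MvPolynomial.X i) = γ i := fun i => MvPolynomial.eval₂Hom_X' _ _ i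
    have hΦsurj : Function.Surjective Φ := by
      rintro ⟨x, hx⟩
      refine Algebra.adjoin_induction (p := fun x hx => ∃ P, Φ P = ⟨x, hx⟩) ?_ ?_ ?_ ?_ hx
      · rintro x (hxC | ⟨i, rfl⟩)
        · exact ⟨MvPolynomial.C ⟨x, hxC⟩, by rw [hΦC]; rfl⟩
        · exact ⟨MvPolynomial.X i, by rw [hΦX]⟩
      · exact fun r => ⟨MvPolynomial.C (algebraMap k C r), by rw [hΦC]; rfl⟩
      · rintro x y _ _ ⟨P, hP⟩ ⟨Q, hQ⟩
        exact ⟨P + Q, by rw [map_add, hP, hQ]; rfl⟩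
      · rintro x y _ _ ⟨P, hP⟩ ⟨Q, hQ⟩
        exact ⟨P * Q, by rw [map_mul, hP, hQ]; rfl⟩
    -- `N := Φ⁻¹ 𝔠'` is maximal
    set N : Ideal (MvPolynomial (Fin n) C) := Ideal.comap Φ 𝔠' with hNdef
    haveI hNmax : N.IsMaximal := Ideal.comap_isMaximal_of_surjective Φ hΦsurj
    -- reduction of coefficients modulo `𝔠`
    set ρ : MvPolynomial (Fin n) C →+* MvPolynomial (Fin n) (C ⧸ 𝔠) :=
      MvPolynomial.map (Ideal.Quotient.mk 𝔠) with hρdef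
    have hρsurj : Function.Surjective ρ :=
      MvPolynomial.map_surjective _ Ideal.Quotient.mk_surjective
    have hker : RingHom.ker ρ = Ideal.map MvPolynomial.C 𝔠 := by
      rw [hρdef, MvPolynomial.ker_map, Ideal.mk_ker]
    have hkerN : RingHom.ker ρ ≤ N := by
      rw [hker, Ideal.map_le_iff_le_comap]
      intro c hc
      rw [Ideal.mem_comap, hNdef, Ideal.mem_comap, hΦC, hmemC']
      exact (hmemC c).mp hc
    -- `M := ρ(N)` is a maximal ideal of `κ[X₁, …, Xₙ]`, `κ = C/𝔠`
    haveI hMmax : (N.map ρ).IsMaximal := Ideal.IsMaximal.map_of_surjective_of_ker_le hρsurj hkerN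
    -- INPUT S3a: maximal ideals of `κ[X₁, …, Xₙ]` are generated by `n` elements
    obtain ⟨h, hM⟩ := stub_dr_mvPolynomial_maximal_span (C ⧸ 𝔠) n (N.map ρ) hMmax
    -- lift the generators into `N`
    have hH : ∀ i, ∃ H, H ∈ N ∧ ρ H = h i := fun i =>
      (Ideal.mem_map_iff_of_surjective ρ hρsurj).mp (hM ▸ Ideal.subset_span ⟨i, rfl⟩)
    choose H hHN hHρ using hH
    refine ⟨fun i => ((Φ (H i) : C') : K), fun i => (Φ (H i)).2, ?_⟩
    simp only [Subtype.coe_eta]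
    refine le_antisymm ?_ ?_
    · rw [Ideal.span_le]
      rintro _ (rfl | ⟨i, rfl⟩)
      · exact (hmemC' _).mpr hlt
      · exact Ideal.mem_comap.mp (hHN i)
    · intro x hx
      obtain ⟨P, rfl⟩ := hΦsurj x
      have hPN : P ∈ N := Ideal.mem_comap.mpr hx
      have hρP : ρ P ∈ Ideal.span (Set.range h) := hM ▸ Ideal.mem_map_of_mem ρ hPN
      obtain ⟨q, hq⟩ := Ideal.mem_span_range_iff_exists_fun.mp hρP
      obtain ⟨Q, hQ⟩ : ∃ Q : Fin n → MvPolynomial (Fin n) C, ∀ i, ρ (Q i) = q i :=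
        ⟨fun i => (hρsurj (q i)).choose, fun i => (hρsurj (q i)).choose_spec⟩
      have hdiff : P - ∑ i, Q i * H i ∈ Ideal.map MvPolynomial.C 𝔠 := by
        rw [← hker, RingHom.mem_ker, map_sub, map_sum]
        simp_rw [map_mul, hQ, hHρ]
        rw [hq, sub_self]
      -- `Φ(𝔠 · C[X]) = 𝔠 · C' ⊆ t · C'`
      have hle : Ideal.map Φ (Ideal.map MvPolynomial.C 𝔠) ≤ Ideal.span {(⟨t, htC'⟩ : C')} := by
        have hcomp : Φ.comp MvPolynomial.C = ι := MvPolynomial.eval₂Hom_comp_C _ _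
        rw [Ideal.map_map, hcomp, ← hspan, Ideal.map_span, Ideal.span_le]
        rintro _ ⟨y, hy, rfl⟩
        rcases hy with rfl | ⟨i, rfl⟩
        · exact Ideal.mem_span_singleton_self _
        · rw [SetLike.mem_coe, Ideal.mem_span_singleton']
          exact ⟨γ i, Subtype.ext (div_mul_cancel₀ (g i) ht0)⟩
      have hsplit : Φ P = Φ (P - ∑ i, Q i * H i) + ∑ i, Φ (Q i) * Φ (H i) := by
        simp only [map_sub, map_sum, map_mul, sub_add_cancel]
      rw [hsplit]
      refine Ideal.add_mem _
        (Ideal.span_mono (Set.singleton_subset_iff.mpr (Set.mem_insert _ _))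
          (hle (Ideal.mem_map_of_mem Φ hdiff)))
        (Ideal.sum_mem _ fun i _ => Ideal.mul_mem_left _ _
          (Ideal.subset_span (Set.mem_insert_of_mem _ ⟨i, rfl⟩)))
  exact ⟨C', hC', hfg, hCC', hbir, htC', g', hg', hspan', hdiv⟩

end Summit.ResolutionOfSingularities.ResolutionOfSingularities.Theorems.IndSmoothBirth

end
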